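import Mathlib
import Summits.NavierStokesRegularity.NavierStokesRegularity.Theorems.L3TimeExponentPincerSubparabolicMorreyJaw
import HarnessLib.Audit
import HarnessLib

/-!
# Sub-parabolic Morrey + a dissipation rate `δ(t) ≲ (T-t)^{-γ}`, `γ ≤ 1`, give the `L³`-Type-I pace and
# `K₃(1)` (route `L3TimeExponentPincer`, child crux `stmt-NavierStokesRegularity-19139` EffSatBlowup, line `pace`;
# support file 12 of seat p4)

Support file (cell ns-regularity-ideate, seat p4, gen 5).  0 `sorry`, no definitions.

nsreg-p4 g4's census for the child crux recommended a DISSIPATION-RATE first node `∫|∇u(t)|² ≲ (T-t)^{-1}` on the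
full-Morrey class.  With THEOREM J‴'s pointwise bound (support file 10, `l3cube_sq_le_of_subparabolicMorrey`:
`‖u(t)‖₃⁶ ≤ C₁ δ(t) + C₂/(T-t)` on the SUB-PARABOLIC Morrey class) that node does exactly what was hoped, on the
larger sub-parabolic class and for every exponent up to the critical one:

* `l3Slow_of_subparabolicMorrey_of_dissipRate` — `SubparabolicMorreyNear u T` and
  `δ(t) ≤ D (T-t)^{-γ}` near `T` with `γ ≤ 1` ⇒ `L3Slow u T` (`‖u(t)‖₃³ ≤ A/√(T-t)`, stub 2's conclusion), with
  `A² = C₁ D + C₂` on the window `T - t < 1`;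
* `effSatNear_of_subparabolicMorrey_of_dissipRate_of_blowup` — for a frame blow-up the crux clause
  `EffSatNear u T` (= `K₃(1)`) follows (landed stub 1 + slow slice, `effSatNear_of_blowup_of_l3Slow`).

Calibration: Leray's lower bound at a blow-up is `δ ≳ (T-t)^{-1/2}`, self-similar / time-Type-I profiles have
`γ = 1/2`, Hou's interior candidate fits `γ = 1/2` (nsreg-p2 ROUND-10 Addendum A); the node here allows every
`γ ≤ 1` — twice the self-similar exponent — whereas the dissipation axis ALONE needs `γ ≤ 4/5` for the parent
clause (`…DissipationAxis.l3CascadeJaw_clause_of_dissipPowerRate`) and gives nothing for the child.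
WHAT THIS IS NOT: not a claim about Navier–Stokes regularity; neither hypothesis is asserted for actual
blow-ups; no item or stub is closed.
-/

noncomputable section

namespace Summit.NavierStokesRegularity.NavierStokesRegularity.Theorems.L3TimeExponentPincerSubparabolicDissipationPace

open MeasureTheory Set Function Filter Metric Topology
open scoped ENNReal NNReal
open Literature.Analysis.FluidPDE
open Summit.NavierStokesRegularity.NavierStokesRegularity.Theorems.L3TimeExponentPincerJawFullMorrey (dissipRate)
open Summit.NavierStokesRegularity.NavierStokesRegularity.Theorems.L3TimeExponentPincerPaceDichotomy
  (EffSatNear L3Slow)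
open Summit.NavierStokesRegularity.NavierStokesRegularity.Theorems.L3TimeExponentPincerStubParabolicConcentration
  (effSatNear_of_blowup_of_l3Slow)
open Summit.NavierStokesRegularity.NavierStokesRegularity.Theorems.L3TimeExponentPincerFullMorreyMostTimes
  (eLpNorm_three_rpow_six_eq eLpNorm_three_rpow_six_eq_sq)
open Summit.NavierStokesRegularity.NavierStokesRegularity.Theorems.L3TimeExponentPincerSubparabolicMorreyJaw
  (SubparabolicMorreyNear l3cube_sq_le_of_subparabolicMorrey)

/-- **Sub-parabolic Morrey + dissipation rate `γ ≤ 1` ⇒ `L³`-Type-I pace.**  For a classical solution on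
`[0,T)`, Leray–Hopf from `u 0`, sub-parabolic-Morrey near `T`, whose dissipation rate satisfies
`∫|∇u(t)|² ≤ D (T-t)^{-γ}` on a final window with `0 ≤ D` and `γ ≤ 1`: `L3Slow u T`. -/
theorem l3Slow_of_subparabolicMorrey_of_dissipRate {ν T : ℝ} (hν : 0 < ν) (hT : 0 < T)
    {u : ℝ → (EuclideanSpace ℝ (Fin 3)) → (EuclideanSpace ℝ (Fin 3))} {p : ℝ → (EuclideanSpace ℝ (Fin 3)) → ℝ}
    (hcl : IsClassicalNSSolutionOn (Ico 0 T) ν 0 u p) (hLH : IsLerayHopfOn T ν 0 (u 0) u)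
    (hS : SubparabolicMorreyNear u T) {D γ : ℝ} (hD : 0 ≤ D) (hγ : γ ≤ 1)
    (hrate : ∃ T₁ < T, ∀ t ∈ Ioo T₁ T, dissipRate u t ≤ ENNReal.ofReal (D * (T - t) ^ (-γ))) :
    L3Slow u T := by
  obtain ⟨T₂, hT₂, C₁, hC₁, C₂, hC₂, hpt⟩ := l3cube_sq_le_of_subparabolicMorrey hν hT hcl hLH hS
  obtain ⟨T₁, hT₁, hrate⟩ := hrate
  -- the constant: `A² = C₁ D + C₂ + 1`
  set c₁ : ℝ := C₁.toReal with hc₁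
  have hc₁nn : 0 ≤ c₁ := ENNReal.toReal_nonneg
  set A : ℝ := Real.sqrt (c₁ * D + C₂ + 1) with hA
  have hApos : 0 < A := Real.sqrt_pos.2 (by positivity)
  have hAsq : A ^ 2 = c₁ * D + C₂ + 1 := Real.sq_sqrt (by positivity)
  refine ⟨A, hApos, max (max T₁ T₂) (T - 1), max_lt (max_lt hT₁ hT₂.2) (by linarith), fun t ht => ?_⟩
  have htT₁ : T₁ < t := lt_of_le_of_lt ((le_max_left _ _).trans (le_max_left _ _)) ht.1
  have htT₂ : T₂ < t := lt_of_le_of_lt ((le_max_right _ _).trans (le_max_left _ _)) ht.1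
  have ht1 : T - 1 < t := lt_of_le_of_lt (le_max_right _ _) ht.1
  have hs : 0 < T - t := sub_pos.2 ht.2
  have hs1 : T - t < 1 := by linarith
  -- `(T-t)^{-γ} ≤ (T-t)^{-1}` on the window
  have hpow : (T - t) ^ (-γ) ≤ (T - t)⁻¹ := by
    rw [← Real.rpow_neg_one]
    exact Real.rpow_le_rpow_of_exponent_ge hs hs1.le (by linarith)
  -- `‖u‖₃⁶ ≤ C₁ D s^{-γ} + C₂/s ≤ (c₁ D + C₂)/s ≤ A²/s`
  have h6 : eLpNorm (u t) 3 volume ^ (6 : ℝ) ≤ ENNReal.ofReal (A ^ 2 / (T - t)) := by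
    rw [eLpNorm_three_rpow_six_eq]
    calc (∫⁻ y, ‖u t y‖ₑ ^ (3 : ℕ)) ^ 2
        ≤ C₁ * dissipRate u t + ENNReal.ofReal (C₂ / (T - t)) := hpt t ⟨htT₂, ht.2⟩
      _ ≤ C₁ * ENNReal.ofReal (D * (T - t) ^ (-γ)) + ENNReal.ofReal (C₂ / (T - t)) := by
          gcongr; exact hrate t ⟨htT₁, ht.2⟩
      _ ≤ ENNReal.ofReal c₁ * ENNReal.ofReal (D * (T - t)⁻¹) + ENNReal.ofReal (C₂ / (T - t)) :=
          add_le_add (mul_le_mul' (le_of_eq (ENNReal.ofReal_toReal hC₁).symm)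
            (ENNReal.ofReal_le_ofReal (mul_le_mul_of_nonneg_left hpow hD))) le_rfl
      _ = ENNReal.ofReal ((c₁ * D + C₂) / (T - t)) := by
          rw [← ENNReal.ofReal_mul hc₁nn, ← ENNReal.ofReal_add (by positivity) (by positivity)]
          congr 1
          field_simp
      _ ≤ ENNReal.ofReal (A ^ 2 / (T - t)) := by
          refine ENNReal.ofReal_le_ofReal (div_le_div_of_nonneg_right ?_ hs.le)
          rw [hAsq]; linarith
  -- take square roots: `‖u‖₃³ ≤ A/√s`
  have h1 : eLpNorm (u t) 3 volume ^ (6 : ℝ) = (eLpNorm (u t) 3 volume ^ (3 : ℝ)) ^ 2 :=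
    eLpNorm_three_rpow_six_eq_sq volume (u t)
  have h2 : ENNReal.ofReal (A ^ 2 / (T - t)) = ENNReal.ofReal (A / Real.sqrt (T - t)) ^ 2 := by
    rw [← ENNReal.ofReal_pow (by positivity)]
    congr 1
    rw [div_pow, Real.sq_sqrt hs.le]
  rw [h1, h2] at h6
  exact (ENNReal.pow_le_pow_left_iff two_ne_zero).1 h6

/-- **… ⇒ the crux clause `K₃(1)` for blow-ups**: a frame blow-up (rapidly decaying datum, no smooth extension
past `T`) that is sub-parabolic-Morrey near `T` with dissipation rate `∫|∇u(t)|² ≤ D (T-t)^{-γ}`, `γ ≤ 1`,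
satisfies `EffSatNear u T` (stub 1 + the slow slice). -/
theorem effSatNear_of_subparabolicMorrey_of_dissipRate_of_blowup {ν T : ℝ} (hν : 0 < ν) (hT : 0 < T)
    {u : ℝ → (EuclideanSpace ℝ (Fin 3)) → (EuclideanSpace ℝ (Fin 3))} {p : ℝ → (EuclideanSpace ℝ (Fin 3)) → ℝ}
    (hcl : IsClassicalNSSolutionOn (Ico 0 T) ν 0 u p) (hLH : IsLerayHopfOn T ν 0 (u 0) u)
    (hdec : HasRapidSpatialDecay (u 0)) (hnext : ¬ HasSmoothExtensionPast ν 0 u T)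
    (hS : SubparabolicMorreyNear u T) {D γ : ℝ} (hD : 0 ≤ D) (hγ : γ ≤ 1)
    (hrate : ∃ T₁ < T, ∀ t ∈ Ioo T₁ T, dissipRate u t ≤ ENNReal.ofReal (D * (T - t) ^ (-γ))) :
    EffSatNear u T :=
  effSatNear_of_blowup_of_l3Slow hν hT hcl hLH hdec hnext
    (l3Slow_of_subparabolicMorrey_of_dissipRate hν hT hcl hLH hS hD hγ hrate)

end Summit.NavierStokesRegularity.NavierStokesRegularity.Theorems.L3TimeExponentPincerSubparabolicDissipationPace

end
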